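import Literature.NumberTheory.LFunctions.RodgersTaoGapBoundProofs
import Literature.NumberTheory.LFunctions.RodgersTaoHamiltonianProofs
import HarnessLib

/-!
# Rodgers–Tao 2020, Lemma 20 (= arXiv v4 Lemma 7.5, «long-range decay of `H̃_{jk}`»): the
# RH-free CONTENT of its proof — far field, middle-field engine, near field, bounded indices

LABEL (cell rh-crit, corpus C3 = Rodgers–Tao/Dobner, seat rt-t2; trunk T-ANT; LADDER-RH §1 COLUMN 3
DBN, bears_on N-C/N-P): **RH-FREE CONTENT.** Proofs only — NO definition, NO named fact. Part I of
the content twin of the printed Lemma 20 (`rodgers_tao_renormHamiltonian_decay` in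
`RodgersTaoHamiltonian.lean`, VACUOUS-AS-PRINTED on `Λ/2 ≤ t ≤ 0` and discharged there EX FALSO):
the four ingredients of the printed proof (FMP p. 45) as stand-alone RH-free theorems at a fixed
time `t > Λ`, with the macroscopic location law (50) and the gap law (52) entering as HYPOTHESES
(schema form, as in `RodgersTaoGapBoundProofs.lean`) and all constants explicit. The assembly into
the three-clause statement with a slowly decaying `ε(j)` (Part II) is a separate leaf module.

* §0 `location_zstar_of_nat` ((50) over `ℤ*` from its `ℕ`-form), `logPlus_pair_le`,
  `logPlus_add_logPlus_le`, `renormLog_le_add_posLog` ((70): `L(u) ≤ u + max(0, log(1/u))`).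
* §1 FAR FIELD `renormHamiltonianZ_le_of_far`: with `Λ = log₊(|ξ_j| + |ξ_k|)`, if
  `4BΛ²/c₂ ≤ |k − j|` then `H̃_{jk}(t) ≤ 8B²Λ⁴/(c₂²(k − j)²)` — the printed regimes
  `|k − j| ≥ |j|/2` and `ε(j)⁻¹ log₊² ξ_j ≤ |k − j| < |j|/2` («`(x_k − x_j)/(ξ_k − ξ_j) − 1 ≪
  log₊²/|k − j|` and (70)»), from (50) and (44) only.
* §2 NEAR FIELD `renormHamiltonianZ_le_of_near`: for `|k − j| ≤ W` and `H_{jk}(t) ≤ P`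
  (Proposition 13), `H̃_{jk}(t) ≤ 1 + 2BΛ²/c₂ + max(0, log(C₂W) − log Λ + P)` («the claim follows
  from Proposition 13 and (70)»).
* §3 MIDDLE-FIELD ENGINE: `classicalLocation_block_estimate` ((45) in the corrected form
  `lemma31_iii_holds` + the `O(1)` discrepancy `4π(q−p)(1/log(ξ_p/4π) − 1/log₊ ξ_p)` over blocks
  of length `≤ log₊² ξ_a`), `zero_block_estimate` (+ (52) at precision `η`), `zero_chain_estimate`
  («(52) iterated `O(ε(j)⁻¹)` times»: `|(x_b − x_a) − (ξ_b − ξ_a)| ≤ m(η log₊ ξ_b + A₃ + 80π)`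
  along `m` blocks).
* §4 `renormHamiltonianZ_le_of_chain` (middle field: `H̃_{ab} ≤ 2(EΛ/(c₂(b−a)))²` once
  `EΛ/(c₂(b−a)) ≤ 1/2`), `renormHamiltonianZ_neg_neg` (`j ↦ −j`),
  `exists_renormHamiltonianZ_le_of_bounded` («the bounded case may be treated by compactness»:
  `exists_bound_deBruijnZeroZ`, `exists_uniform_gap_lower`).

Source: B. Rodgers, T. Tao, *The de Bruijn–Newman constant is non-negative*, Forum Math. Pi 8
(2020) e6 (`RodgersTaoFMP2020`) = arXiv:1801.05914; VERSION/PAGES OPENED: v5 TeX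
`rh-crit/rt/src/RodgersTao_arXiv1801.05914v5.tex` l.1087–1173 (§7: (70), (71), Lemma 19,
Lemma 20 and its proof), FMP pp. 44–45; Lemma 8 (44)–(45) p. 21; Corollary 10 (50)–(52) p. 23.

DIVERGENCES (announced rt/STATUS 11:54Z): constants explicit; the far field is derived from (50) +
(44) for `|k − j| ≥ 4BΛ²/c₂` uniformly (the printed proof splits at `|j|/2`); in the engine the
main term of (52) is compared with (45)'s corrected main term `4π(k−j)/log(ξ_j/4π)`
(`lemma31_iii`, ERRATUM E7 of the §3 file) — the discrepancy is `≤ 80π` per block. Nothing in this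
file is worded as, or is, progress toward RH.

## References

* [RodgersTaoFMP2020] B. Rodgers, T. Tao, Forum Math. Pi 8 (2020) e6 = arXiv:1801.05914v4/v5:
  Lemma 20 p. 45 (= v4 Lemma 7.5) and its proof; (70)–(71) p. 44; Lemma 8 p. 21; Cor. 10 p. 23.

WHAT THIS IS NOT: not Lemma 20 at `t = 0`; no assertion of (50)/(52) at any `t ≥ Λ`; not progress
toward RH — nothing here bears on the truth of RH.
-/

noncomputable section

open Real Set Filter Topology

namespace Literature.NumberTheory.LFunctions

/-! ## §0. The renormalised logarithm from above ((70), upper halves) and the inputs over `ℤ*` -/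

/-- (70), crude upper half: `L(u) = u − 1 + log(1/u) ≤ u + max(0, log(1/u))` for `u > 0`
(«`L(x) ≍ log₊(1/|x|)` for small `|x|`, «`L(x) ≍ |x|`» for large `|x|`).
[cite: RodgersTaoFMP2020, §7 p. 44 (70)] -/
theorem renormLog_le_add_posLog {u : ℝ} (hu : 0 < u) :
    renormLog u ≤ u + max 0 (Real.log (1 / u)) := by
  rw [renormLog_eq_def, abs_of_pos hu]
  have := le_max_right 0 (Real.log (1 / u))
  linarith

/-- `|ξ^{ℤ}_j| = ξ_{|j|}` and the location law over `ℤ*`: from the `ℕ`-indexed (50),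
`|x_j(t) − ξ_j| ≤ B log₊ ξ_j` for every `j ∈ ℤ*` (odd extensions on both sides; `log₊` is even).
[cite: RodgersTaoFMP2020, Corollary 10 (50) p. 23 («for all `j ∈ ℤ*`»)] -/
theorem location_zstar_of_nat {t B : ℝ}
    (h50 : ∀ n : ℕ, 1 ≤ n →
      |deBruijnZero t n - classicalLocation (n : ℝ)| ≤ B * logPlus (classicalLocation (n : ℝ)))
    {j : ℤ} (hj : j ≠ 0) :
    |deBruijnZeroZ t j - classicalLocationZ j| ≤ B * logPlus (classicalLocationZ j) := by
  rcases lt_or_gt_of_ne hj with h | h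
  · obtain ⟨n, hn⟩ := Int.eq_ofNat_of_zero_le (show (0 : ℤ) ≤ -j by omega)
    have hj' : j = -(n : ℤ) := by omega
    have hn1 : 1 ≤ n := by omega
    rw [hj', deBruijnZeroZ_neg, classicalLocationZ_neg, deBruijnZeroZ_natCast,
      classicalLocationZ_natCast (by omega), logPlus_neg, neg_sub_neg, abs_sub_comm]
    exact h50 n hn1
  · obtain ⟨n, rfl⟩ := Int.eq_ofNat_of_zero_le h.le
    have hn1 : 1 ≤ n := by exact_mod_cast h
    rw [deBruijnZeroZ_natCast, classicalLocationZ_natCast (by omega)]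
    exact h50 n hn1

/-- `log₊ ξ_j ≤ log₊(|ξ_j| + |ξ_k|)` (monotonicity of `log₊`). [cite: RodgersTaoFMP2020, §1.2 p. 7] -/
theorem logPlus_classicalLocationZ_le_pair (j k : ℤ) :
    logPlus (classicalLocationZ j) ≤ logPlus (|classicalLocationZ j| + |classicalLocationZ k|) :=
  logPlus_mono (by
    rw [abs_of_nonneg (add_nonneg (abs_nonneg (classicalLocationZ j)) (abs_nonneg (classicalLocationZ k)))]
    exact le_add_of_nonneg_right (abs_nonneg _))

/-- `log₊(|ξ_j| + |ξ_k|) ≤ log(2 + B₀) + log₊ j + log₊ k` whenever `|ξ_i| ≤ B₀ |i|`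
(`exists_abs_classicalLocationZ_le`). [cite: RodgersTaoFMP2020, Lemma 8 (i) (43) p. 21] -/
theorem logPlus_pair_le {B₀ : ℝ} (hB₀ : 0 < B₀) (hξ : ∀ i : ℤ, |classicalLocationZ i| ≤ B₀ * |(i : ℝ)|)
    (j k : ℤ) :
    logPlus (|classicalLocationZ j| + |classicalLocationZ k|) ≤ Real.log (2 + B₀) + logPlus j + logPlus k := by
  have ha := hξ j; have hb := hξ k
  rw [logPlus_eq, logPlus_eq, logPlus_eq,
    abs_of_nonneg (by positivity : (0:ℝ) ≤ |classicalLocationZ j| + |classicalLocationZ k|),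
    ← Real.log_mul (by positivity) (by positivity), ← Real.log_mul (by positivity) (by positivity)]
  refine Real.log_le_log (by positivity) ?_
  nlinarith [abs_nonneg (j : ℝ), abs_nonneg (k : ℝ), mul_nonneg (abs_nonneg (j : ℝ)) (abs_nonneg (k : ℝ)),
    mul_nonneg hB₀.le (mul_nonneg (abs_nonneg (j : ℝ)) (abs_nonneg (k : ℝ))),
    abs_nonneg (classicalLocationZ j), abs_nonneg (classicalLocationZ k)]

/-- `log₊ j + log₊ k ≤ 2 log₊(|j| + |k|)`. [cite: RodgersTaoFMP2020, §1.2 p. 7] -/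
theorem logPlus_add_logPlus_le (j k : ℝ) : logPlus j + logPlus k ≤ 2 * logPlus (|j| + |k|) := by
  have h1 : logPlus j ≤ logPlus (|j| + |k|) := logPlus_mono (by
    rw [abs_of_nonneg (add_nonneg (abs_nonneg j) (abs_nonneg k))]
    exact le_add_of_nonneg_right (abs_nonneg _))
  have h2 : logPlus k ≤ logPlus (|j| + |k|) := logPlus_mono (by
    rw [abs_of_nonneg (add_nonneg (abs_nonneg j) (abs_nonneg k))]
    exact le_add_of_nonneg_left (abs_nonneg _))
  linarith

/-! ## §1. The far field: `H̃_{jk} ≪ log₊⁴(|j| + |k|)/|k − j|²` once `|k − j| ≫ log₊²` (first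
claim of Lemma 20; regimes `|k − j| ≥ |j|/2` and `ε(j)⁻¹ log₊² ξ_j ≤ |k − j| < |j|/2` of the printed
proof, FMP p. 45) -/

/-- **Far field, core form.** With `Λ := log₊(|ξ_j| + |ξ_k|)`: if `4BΛ²/c₂ ≤ |k − j|` then the
ratio `r = (x_j − x_k)/(ξ_j − ξ_k)` satisfies `|r − 1| ≤ 2BΛ²/(c₂|k − j|) ≤ 1/2`, hence
`H̃_{jk}(t) = L(r) ≤ 2(r − 1)² ≤ 8B²Λ⁴/(c₂²(k − j)²)`. Inputs: (50) over `ℤ*` and (44).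
[cite: RodgersTaoFMP2020, Lemma 20 p. 45 (first two paragraphs of the proof)] -/
theorem renormHamiltonianZ_le_of_far {t B c₂ : ℝ} (hB : 0 ≤ B)
    (h50 : ∀ j : ℤ, j ≠ 0 → |deBruijnZeroZ t j - classicalLocationZ j| ≤ B * logPlus (classicalLocationZ j))
    (hc₂ : 0 < c₂)
    (hii : ∀ j k : ℤ, j ≠ 0 → k ≠ 0 →
      c₂ * (|(k : ℝ) - j| / logPlus (|classicalLocationZ j| + |classicalLocationZ k|)) ≤
        |classicalLocationZ k - classicalLocationZ j|)
    {j k : ℤ} (hj : j ≠ 0) (hk : k ≠ 0) (hjk : j ≠ k)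
    (hfar : 4 * B * logPlus (|classicalLocationZ j| + |classicalLocationZ k|) ^ 2 / c₂ ≤ |(k : ℝ) - j|) :
    renormHamiltonianZ t j k ≤
      8 * B ^ 2 * logPlus (|classicalLocationZ j| + |classicalLocationZ k|) ^ 4 /
        (c₂ ^ 2 * ((k : ℝ) - j) ^ 2) := by
  set Λ : ℝ := logPlus (|classicalLocationZ j| + |classicalLocationZ k|) with hΛ
  have hΛ0 : 0 < Λ := logPlus_pos _
  set D : ℝ := classicalLocationZ j - classicalLocationZ k with hD
  set N : ℝ := deBruijnZeroZ t j - deBruijnZeroZ t k with hN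
  have hD0 : D ≠ 0 := by rw [hD]; exact classicalLocationZ_sub_ne_zero (Ne.symm hjk)
  have hkj0 : 0 < |(k : ℝ) - j| := abs_pos.2 (sub_ne_zero.2 (by exact_mod_cast (Ne.symm hjk)))
  -- |N − D| ≤ 2BΛ and |D| ≥ c₂|k−j|/Λ
  have h1 : |N - D| ≤ 2 * B * Λ := by
    have e : N - D = (deBruijnZeroZ t j - classicalLocationZ j) - (deBruijnZeroZ t k - classicalLocationZ k) := by
      rw [hN, hD]; ring
    rw [e]
    refine (abs_sub _ _).trans ?_
    have hj' := (h50 j hj).trans (mul_le_mul_of_nonneg_left (logPlus_classicalLocationZ_le_pair j k) hB)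
    have hk' := (h50 k hk).trans (mul_le_mul_of_nonneg_left
      ((logPlus_classicalLocationZ_le_pair k j).trans (by rw [add_comm])) hB)
    rw [← hΛ] at hj' hk'
    linarith
  have h2 : c₂ * |(k : ℝ) - j| / Λ ≤ |D| := by
    have := hii j k hj hk
    rw [hD, abs_sub_comm (classicalLocationZ j) (classicalLocationZ k), mul_div_assoc]
    exact this
  have hd0 : 0 < c₂ * |(k : ℝ) - j| / Λ := by positivity
  have hDpos : 0 < |D| := hd0.trans_le h2
  -- the ratio
  set r : ℝ := N / D with hr
  have hr1 : |r - 1| ≤ 2 * B * Λ ^ 2 / (c₂ * |(k : ℝ) - j|) := by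
    have e : r - 1 = (N - D) / D := by rw [hr]; field_simp
    rw [e, abs_div]
    calc |N - D| / |D| ≤ (2 * B * Λ) / (c₂ * |(k : ℝ) - j| / Λ) :=
          div_le_div₀ (by positivity) h1 hd0 h2
      _ = 2 * B * Λ ^ 2 / (c₂ * |(k : ℝ) - j|) := by field_simp
  have hr2 : |r - 1| ≤ 1 / 2 := by
    refine hr1.trans ?_
    rw [div_le_iff₀ (by positivity)]
    have := hfar
    rw [div_le_iff₀ hc₂] at this
    linarith
  have hrhalf : 1 / 2 ≤ r := by have := (abs_le.1 hr2).1; linarith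
  have hL : renormHamiltonianZ t j k = renormLog r := by rw [renormHamiltonianZ_eq, hr, hN, hD]
  rw [hL]
  have hrabs : |r| = r := abs_of_pos (by linarith)
  refine (renormLog_le_two_mul_sq (by rw [hrabs]; exact hrhalf)).trans ?_
  rw [hrabs]
  have h3 : (r - 1) ^ 2 ≤ (2 * B * Λ ^ 2 / (c₂ * |(k : ℝ) - j|)) ^ 2 := by
    rw [← sq_abs (r - 1)]
    exact pow_le_pow_left₀ (abs_nonneg _) hr1 2
  have e3 : (c₂ * |(k : ℝ) - j|) ^ 2 = c₂ ^ 2 * ((k : ℝ) - j) ^ 2 := by rw [mul_pow, sq_abs]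
  have e2 : 2 * (2 * B * Λ ^ 2 / (c₂ * |(k : ℝ) - j|)) ^ 2 =
      8 * B ^ 2 * Λ ^ 4 / (c₂ ^ 2 * ((k : ℝ) - j) ^ 2) := by
    rw [div_pow, e3]; ring
  linarith [e2]

/-! ## §2. The near field: `H̃_{jk} ≪ log₊² j · log₊ log₊ j` for `|k − j| ≤ log₊² ξ_j` (third claim
of Lemma 20, «for the remaining case … the claim follows from Proposition 13 and (70)», FMP p. 45) -/

/-- **Near field, core form.** With `Λ := log₊(|ξ_j| + |ξ_k|)`, any `W ≥ 1` with `|k − j| ≤ W`,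
and any `P` with `H_{jk}(t) ≤ P` (Proposition 13): `H̃_{jk}(t) ≤ 1 + 2BΛ²/c₂ + max(0, log(C₂W) − log Λ + P)`,
since `r = |x_j − x_k|/|ξ_j − ξ_k| ≤ 1 + 2BΛ²/(c₂|k−j|)` and `log(1/r) = log|ξ_j − ξ_k| + H_{jk}`,
`|ξ_j − ξ_k| ≤ C₂|k − j|/Λ`. Inputs: (50) over `ℤ*`, both halves of (44), and the ordering of the
zeros (`r > 0`). [cite: RodgersTaoFMP2020, Lemma 20 p. 45 (last paragraph of the proof)] -/
theorem renormHamiltonianZ_le_of_near {t B c₂ C₂ : ℝ}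
    (hΛ : ∃ t₁ : ℝ, t₁ < t ∧ HasOnlyRealZeros (deBruijnH t₁)) (hB : 0 ≤ B)
    (h50 : ∀ j : ℤ, j ≠ 0 → |deBruijnZeroZ t j - classicalLocationZ j| ≤ B * logPlus (classicalLocationZ j))
    (hc₂ : 0 < c₂)
    (hii : ∀ j k : ℤ, j ≠ 0 → k ≠ 0 →
      c₂ * (|(k : ℝ) - j| / logPlus (|classicalLocationZ j| + |classicalLocationZ k|)) ≤
        |classicalLocationZ k - classicalLocationZ j| ∧
      |classicalLocationZ k - classicalLocationZ j| ≤
        C₂ * (|(k : ℝ) - j| / logPlus (|classicalLocationZ j| + |classicalLocationZ k|)))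
    {j k : ℤ} (hj : j ≠ 0) (hk : k ≠ 0) (hjk : j ≠ k) {W P : ℝ} (hW : 1 ≤ W)
    (hkjW : |(k : ℝ) - j| ≤ W) (hP : hamiltonianInteraction t j k ≤ P) :
    renormHamiltonianZ t j k ≤
      1 + 2 * B * logPlus (|classicalLocationZ j| + |classicalLocationZ k|) ^ 2 / c₂ +
        max 0 (Real.log (C₂ * W) - Real.log (logPlus (|classicalLocationZ j| + |classicalLocationZ k|)) + P) := by
  set Λ : ℝ := logPlus (|classicalLocationZ j| + |classicalLocationZ k|) with hΛdef
  have hΛ0 : 0 < Λ := logPlus_pos _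
  set D : ℝ := classicalLocationZ j - classicalLocationZ k with hD
  set N : ℝ := deBruijnZeroZ t j - deBruijnZeroZ t k with hN
  have hkj0 : 0 < |(k : ℝ) - j| := abs_pos.2 (sub_ne_zero.2 (by exact_mod_cast (Ne.symm hjk)))
  have hkj1 : 1 ≤ |(k : ℝ) - j| := by
    rw [← Int.cast_sub, ← Int.cast_abs]; exact_mod_cast Int.one_le_abs (sub_ne_zero.2 (Ne.symm hjk))
  obtain ⟨hii1, hii2⟩ := hii j k hj hk
  have hC₂ : 0 < C₂ := by
    have hq : 0 < |(k : ℝ) - j| / Λ := by positivity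
    have := hii1.trans hii2
    rw [← hΛdef] at this
    exact hc₂.trans_le (le_of_mul_le_mul_right this hq)
  -- signs: N and D have the same sign as j − k
  have hsx := strictMono_deBruijnZeroZ hΛ
  have hsξ := strictMono_classicalLocationZ
  have hrpos : 0 < N / D := by
    rcases lt_or_gt_of_ne hjk with h | h
    · exact div_pos_of_neg_of_neg (by rw [hN]; linarith [hsx h]) (by rw [hD]; linarith [hsξ h])
    · exact div_pos (by rw [hN]; linarith [hsx h]) (by rw [hD]; linarith [hsξ h])
  have hNabs : 0 < |N| := by
    rw [hN]; exact abs_pos.2 (deBruijnZeroZ_sub_ne_zero hΛ (Ne.symm hjk))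
  have hDabs : 0 < |D| := by rw [hD]; exact abs_pos.2 (classicalLocationZ_sub_ne_zero (Ne.symm hjk))
  -- |N| ≤ |D| + 2BΛ, |D| ≥ c₂|k−j|/Λ ≥ c₂/Λ, |D| ≤ C₂ W/Λ
  have h1 : |N| ≤ |D| + 2 * B * Λ := by
    have e : N = D + ((deBruijnZeroZ t j - classicalLocationZ j) - (deBruijnZeroZ t k - classicalLocationZ k)) := by
      rw [hN, hD]; ring
    rw [e]
    refine (abs_add_le _ _).trans ?_
    have hj' := (h50 j hj).trans (mul_le_mul_of_nonneg_left (logPlus_classicalLocationZ_le_pair j k) hB)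
    have hk' := (h50 k hk).trans (mul_le_mul_of_nonneg_left
      ((logPlus_classicalLocationZ_le_pair k j).trans (by rw [add_comm])) hB)
    rw [← hΛdef] at hj' hk'
    linarith [abs_sub (deBruijnZeroZ t j - classicalLocationZ j) (deBruijnZeroZ t k - classicalLocationZ k)]
  have h2 : c₂ / Λ ≤ |D| := by
    have := hii1
    rw [← hΛdef] at this
    rw [hD, abs_sub_comm (classicalLocationZ j) (classicalLocationZ k)]
    refine le_trans ?_ this
    calc c₂ / Λ = c₂ * (1 / Λ) := by ring
      _ ≤ c₂ * (|(k : ℝ) - j| / Λ) :=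
          mul_le_mul_of_nonneg_left (div_le_div_of_nonneg_right hkj1 hΛ0.le) hc₂.le
  have h3 : |D| ≤ C₂ * W / Λ := by
    have := hii2
    rw [← hΛdef] at this
    rw [hD, abs_sub_comm (classicalLocationZ j) (classicalLocationZ k)]
    refine this.trans ?_
    rw [mul_div_assoc]
    exact mul_le_mul_of_nonneg_left (div_le_div_of_nonneg_right hkjW hΛ0.le) hC₂.le
  -- r ≤ 1 + 2BΛ²/c₂
  have hr_eq : N / D = |N| / |D| := by
    rw [← abs_div]; exact (abs_of_pos hrpos).symm
  have h4 : N / D ≤ 1 + 2 * B * Λ ^ 2 / c₂ := by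
    rw [hr_eq, div_le_iff₀ hDabs]
    have e1 : 2 * B * Λ ≤ 2 * B * Λ ^ 2 / c₂ * |D| := by
      have : 2 * B * Λ ^ 2 / c₂ * |D| ≥ 2 * B * Λ ^ 2 / c₂ * (c₂ / Λ) :=
        mul_le_mul_of_nonneg_left h2 (by positivity)
      have e : 2 * B * Λ ^ 2 / c₂ * (c₂ / Λ) = 2 * B * Λ := by field_simp
      linarith
    nlinarith
  -- log(1/r) = log|D| − log|N| = log|D| + H_{jk}
  have h5 : Real.log (1 / (N / D)) ≤ Real.log (C₂ * W) - Real.log Λ + P := by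
    rw [hr_eq, one_div, inv_div, Real.log_div hDabs.ne' hNabs.ne']
    have e1 : Real.log |D| ≤ Real.log (C₂ * W) - Real.log Λ := by
      have := Real.log_le_log hDabs h3
      rwa [Real.log_div (by positivity) hΛ0.ne'] at this
    have e2 : -Real.log |N| = hamiltonianInteraction t j k := by
      rw [hamiltonianInteraction_eq_neg_log, hN]
    linarith
  have hL : renormHamiltonianZ t j k = renormLog (N / D) := by rw [renormHamiltonianZ_eq, hN, hD]
  rw [hL]
  refine (renormLog_le_add_posLog hrpos).trans ?_
  have h6 : max 0 (Real.log (1 / (N / D))) ≤ max 0 (Real.log (C₂ * W) - Real.log Λ + P) :=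
    max_le_max le_rfl h5
  linarith


/-! ## §3. The middle field engine: iterating (52) along blocks of length `≤ log₊² ξ`
(«from (52) (iterated `O(ε(j)⁻¹)` times) and (45) we have
`x_k(t) − x_j(t) = ξ_k − ξ_j + o(ε(j)⁻¹ log j)`», FMP p. 45) -/

section Engine

variable {t : ℝ}

/-- `log₊ ξ ≤ 5 log(ξ/4π)` for `ξ = ξ_y`, `y ≥ 1` (`log₊ ξ ≤ log ξ + 1`, `log ξ ≤ 4 log(ξ/4π)`,
`1 < log(ξ/4π)`). [cite: RodgersTaoFMP2020, §3 p. 21 (proof of Lemma 8)] -/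
theorem logPlus_classicalLocation_le_five_mul_log {y : ℝ} (hy : 1 ≤ y) :
    logPlus (classicalLocation y) ≤ 5 * Real.log (classicalLocation y / (4 * π)) := by
  have hξ : 0 < classicalLocation y := classicalLocation_pos (by linarith)
  have h1 := RodgersTao2020.log_classicalLocation_le hy
  have h2 := RodgersTao2020.one_lt_log_classicalLocation_div hy
  have h3 : logPlus (classicalLocation y) ≤ Real.log (classicalLocation y) + 1 := by
    rw [logPlus_eq, abs_of_pos hξ]
    have e : 2 + classicalLocation y ≤ Real.exp 1 * classicalLocation y := by
      have := Real.add_one_le_exp (1 : ℝ)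
      have h4 : 4 * π ≤ classicalLocation y := four_pi_le_classicalLocation (by linarith)
      nlinarith [Real.pi_gt_three]
    calc Real.log (2 + classicalLocation y) ≤ Real.log (Real.exp 1 * classicalLocation y) :=
          Real.log_le_log (by positivity) e
      _ = Real.log (classicalLocation y) + 1 := by
          rw [Real.log_mul (Real.exp_pos 1).ne' hξ.ne', Real.log_exp]; ring
  linarith

/-- **Per-block estimate for the classical locations** (display (45), corrected form
`lemma31_iii_holds` with `K = 2`, plus the `O(1)` discrepancy between the main terms
`4π(q−p)/log(ξ_p/4π)` and `4π(q−p)/log₊ ξ_p` over a block of length `≤ W ≤ log₊² ξ_a`,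
`W² ≤ a`): `|(ξ_q − ξ_p) − 4π(q−p)/log₊ ξ_p| ≤ A₃ + 80π` for `a ≤ p < q ≤ p + W`.
[cite: RodgersTaoFMP2020, Lemma 20 p. 45 (third paragraph of the proof: (52) + (45))] -/
theorem classicalLocation_block_estimate {A₃ : ℝ}
    (h45 : ∀ p q : ℝ, 1 ≤ p → 1 ≤ q → p ≤ 2 * q → q ≤ 2 * p →
      |classicalLocation q - classicalLocation p -
          4 * π * (q - p) / Real.log (classicalLocation p / (4 * π))| ≤
        A₃ * ((q - p) ^ 2 / (p * Real.log (classicalLocation p) ^ 2)))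
    {a : ℕ} {W : ℝ} (ha : 1 ≤ a) (hWa : W ^ 2 ≤ a)
    (hW : W ≤ logPlus (classicalLocation (a : ℝ)) ^ 2)
    {p q : ℕ} (hap : a ≤ p) (hpq : p < q) (hqp : (q : ℝ) - p ≤ W) :
    |(classicalLocation (q : ℝ) - classicalLocation (p : ℝ)) -
        4 * π * ((q : ℝ) - p) / logPlus (classicalLocation (p : ℝ))| ≤ A₃ + 80 * π := by
  have haR : (1 : ℝ) ≤ a := by exact_mod_cast ha
  have hpR : (a : ℝ) ≤ p := by exact_mod_cast hap
  have hp1 : (1 : ℝ) ≤ p := haR.trans hpR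
  have hqp1 : (1 : ℝ) ≤ (q : ℝ) - p := by
    have h' : ((p + 1 : ℕ) : ℝ) ≤ q := by exact_mod_cast Nat.succ_le_of_lt hpq
    push_cast at h'; linarith
  have hW1 : 1 ≤ W := hqp1.trans hqp
  have hWa' : W ≤ a := by nlinarith
  have hq1 : (1 : ℝ) ≤ q := by linarith
  have hq2p : (q : ℝ) ≤ 2 * p := by linarith
  have hp2q : (p : ℝ) ≤ 2 * q := by linarith
  -- (45)
  have h1 := h45 p q hp1 hq1 hp2q hq2p
  set ξp : ℝ := classicalLocation (p : ℝ) with hξp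
  have hξp0 : 0 < ξp := classicalLocation_pos (by linarith)
  have hlog1 : 1 < Real.log (ξp / (4 * π)) := RodgersTao2020.one_lt_log_classicalLocation_div hp1
  have hlogle : Real.log (ξp / (4 * π)) ≤ Real.log ξp := RodgersTao2020.log_classicalLocation_div_le hp1
  have hA₃0 : 0 ≤ A₃ := by
    have h0 : 0 ≤ A₃ * ((q - p : ℝ) ^ 2 / (p * Real.log ξp ^ 2)) := (abs_nonneg _).trans h1
    have hpos : 0 < ((q : ℝ) - p) ^ 2 / (p * Real.log ξp ^ 2) := by
      have : 0 < Real.log ξp := by linarith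
      positivity
    by_contra hA
    push Not at hA
    have := mul_neg_of_neg_of_pos hA hpos
    linarith
  have h2 : A₃ * (((q : ℝ) - p) ^ 2 / (p * Real.log ξp ^ 2)) ≤ A₃ := by
    have hlogξ : 1 ≤ Real.log ξp := by linarith
    have e1 : ((q : ℝ) - p) ^ 2 ≤ W ^ 2 := pow_le_pow_left₀ (by linarith) hqp 2
    have e2 : ((q : ℝ) - p) ^ 2 / (p * Real.log ξp ^ 2) ≤ 1 := by
      rw [div_le_one (by positivity)]
      have hl2 : (1 : ℝ) ≤ Real.log ξp ^ 2 := one_le_pow₀ hlogξ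
      have : (a : ℝ) ≤ p * Real.log ξp ^ 2 :=
        calc (a : ℝ) ≤ p := hpR
          _ = p * 1 := (mul_one _).symm
          _ ≤ p * Real.log ξp ^ 2 := mul_le_mul_of_nonneg_left hl2 (by linarith)
      linarith
    exact (mul_le_mul_of_nonneg_left e2 hA₃0).trans (by rw [mul_one])
  -- the discrepancy of the main terms
  set L : ℝ := logPlus ξp with hL
  have hL5 : L ≤ 5 * Real.log (ξp / (4 * π)) := logPlus_classicalLocation_le_five_mul_log hp1
  have hL0 : 0 < L := logPlus_pos _
  have hdiff0 : 0 ≤ L - Real.log (ξp / (4 * π)) := by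
    rw [hL, logPlus_eq, abs_of_pos hξp0, Real.log_div hξp0.ne' (by positivity)]
    have : Real.log ξp ≤ Real.log (2 + ξp) := Real.log_le_log hξp0 (by linarith)
    have : 0 < Real.log (4 * π) := by have := RodgersTao2020.two_lt_log_four_pi; linarith
    linarith
  have hdiff4 : L - Real.log (ξp / (4 * π)) ≤ 4 := by
    rw [hL, logPlus_eq, abs_of_pos hξp0, Real.log_div hξp0.ne' (by positivity)]
    have e : Real.log (2 + ξp) ≤ Real.log ξp + 1 := by
      have h4 : 4 * π ≤ ξp := four_pi_le_classicalLocation (by linarith)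
      calc Real.log (2 + ξp) ≤ Real.log (Real.exp 1 * ξp) :=
            Real.log_le_log (by positivity) (by nlinarith [Real.add_one_le_exp (1 : ℝ), Real.pi_gt_three])
        _ = Real.log ξp + 1 := by rw [Real.log_mul (Real.exp_pos 1).ne' hξp0.ne', Real.log_exp]; ring
    have := RodgersTao2020.log_four_pi_lt_three
    linarith
  have hWL : W ≤ L ^ 2 := by
    refine hW.trans (pow_le_pow_left₀ (logPlus_nonneg _) ?_ 2)
    exact logPlus_classicalLocation_mono haR hpR
  have h3 : |4 * π * ((q : ℝ) - p) / Real.log (ξp / (4 * π)) - 4 * π * ((q : ℝ) - p) / L| ≤ 80 * π := by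
    have e : 4 * π * ((q : ℝ) - p) / Real.log (ξp / (4 * π)) - 4 * π * ((q : ℝ) - p) / L =
        4 * π * ((q : ℝ) - p) * ((L - Real.log (ξp / (4 * π))) / (Real.log (ξp / (4 * π)) * L)) := by
      field_simp
    rw [e, abs_of_nonneg (by positivity)]
    have f1 : 4 * π * ((q : ℝ) - p) ≤ 4 * π * L ^ 2 := by nlinarith [Real.pi_pos]
    have f2 : (L - Real.log (ξp / (4 * π))) / (Real.log (ξp / (4 * π)) * L) ≤ 4 / (Real.log (ξp / (4 * π)) * L) :=
      div_le_div_of_nonneg_right hdiff4 (by positivity)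
    have f3 : 4 * π * L ^ 2 * (4 / (Real.log (ξp / (4 * π)) * L)) = 16 * π * (L / Real.log (ξp / (4 * π))) := by
      field_simp; ring
    have f4 : L / Real.log (ξp / (4 * π)) ≤ 5 := by rw [div_le_iff₀ (by linarith)]; linarith
    calc 4 * π * ((q : ℝ) - p) * ((L - Real.log (ξp / (4 * π))) / (Real.log (ξp / (4 * π)) * L))
        ≤ 4 * π * L ^ 2 * (4 / (Real.log (ξp / (4 * π)) * L)) :=
          mul_le_mul f1 f2 (by positivity) (by positivity)
      _ = 16 * π * (L / Real.log (ξp / (4 * π))) := f3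
      _ ≤ 80 * π := by nlinarith [Real.pi_pos]
  -- combine
  have e3 : classicalLocation (q : ℝ) - ξp - 4 * π * ((q : ℝ) - p) / L =
      (classicalLocation (q : ℝ) - ξp - 4 * π * ((q : ℝ) - p) / Real.log (ξp / (4 * π))) +
        (4 * π * ((q : ℝ) - p) / Real.log (ξp / (4 * π)) - 4 * π * ((q : ℝ) - p) / L) := by ring
  rw [e3]
  exact (abs_add_le _ _).trans (by linarith [h1.trans h2])

/-- **Per-block estimate for the zeros against the classical locations**: with (52) at precision
`η` from scale `a₀ ≤ a` and `classicalLocation_block_estimate`,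
`|(x_q − x_p) − (ξ_q − ξ_p)| ≤ η log₊ ξ_p + A₃ + 80π` for `a ≤ p < q ≤ p + W`.
[cite: RodgersTaoFMP2020, Lemma 20 p. 45 (third paragraph of the proof)] -/
theorem zero_block_estimate {A₃ η : ℝ} {a₀ a : ℕ} {W : ℝ}
    (h45 : ∀ p q : ℝ, 1 ≤ p → 1 ≤ q → p ≤ 2 * q → q ≤ 2 * p →
      |classicalLocation q - classicalLocation p -
          4 * π * (q - p) / Real.log (classicalLocation p / (4 * π))| ≤
        A₃ * ((q - p) ^ 2 / (p * Real.log (classicalLocation p) ^ 2)))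
    (h52 : ∀ p q : ℕ, a₀ ≤ p → p < q → (q : ℝ) ≤ p + logPlus (classicalLocation (p : ℝ)) ^ 2 →
      |deBruijnZero t q - deBruijnZero t p -
          4 * π * ((q : ℝ) - p) / logPlus (classicalLocation (p : ℝ))| ≤
        η * logPlus (classicalLocation (p : ℝ)))
    (ha₀ : a₀ ≤ a) (ha : 1 ≤ a) (hWa : W ^ 2 ≤ a) (hW : W ≤ logPlus (classicalLocation (a : ℝ)) ^ 2)
    {p q : ℕ} (hap : a ≤ p) (hpq : p < q) (hqp : (q : ℝ) - p ≤ W) :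
    |(deBruijnZero t q - deBruijnZero t p) - (classicalLocation (q : ℝ) - classicalLocation (p : ℝ))| ≤
      η * logPlus (classicalLocation (p : ℝ)) + (A₃ + 80 * π) := by
  have h1 := classicalLocation_block_estimate h45 ha hWa hW hap hpq hqp
  have hWp : W ≤ logPlus (classicalLocation (p : ℝ)) ^ 2 :=
    hW.trans (pow_le_pow_left₀ (logPlus_nonneg _)
      (logPlus_classicalLocation_mono (by exact_mod_cast ha) (by exact_mod_cast hap)) 2)
  have h2 := h52 p q (ha₀.trans hap) hpq (by linarith)
  have e : (deBruijnZero t q - deBruijnZero t p) - (classicalLocation (q : ℝ) - classicalLocation (p : ℝ)) =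
      (deBruijnZero t q - deBruijnZero t p - 4 * π * ((q : ℝ) - p) / logPlus (classicalLocation (p : ℝ))) -
        (classicalLocation (q : ℝ) - classicalLocation (p : ℝ) -
          4 * π * ((q : ℝ) - p) / logPlus (classicalLocation (p : ℝ))) := by ring
  rw [e]
  exact (abs_sub _ _).trans (by linarith)

/-- **The chain** (iterating the block estimate): for a natural block length `W` with
`W ≤ log₊² ξ_a`, `W² ≤ a`, if `b − a' ≤ m·W` then
`|(x_b − x_{a'}) − (ξ_b − ξ_{a'})| ≤ m (η log₊ ξ_b + A₃ + 80π)` for `a ≤ a' ≤ b`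
(«(52) iterated `O(ε(j)⁻¹)` times», FMP p. 45). [cite: RodgersTaoFMP2020, Lemma 20 p. 45 (third paragraph of the proof)] -/
theorem zero_chain_estimate {A₃ η : ℝ} {a₀ a W : ℕ} (hη : 0 ≤ η)
    (h45 : ∀ p q : ℝ, 1 ≤ p → 1 ≤ q → p ≤ 2 * q → q ≤ 2 * p →
      |classicalLocation q - classicalLocation p -
          4 * π * (q - p) / Real.log (classicalLocation p / (4 * π))| ≤
        A₃ * ((q - p) ^ 2 / (p * Real.log (classicalLocation p) ^ 2)))
    (h52 : ∀ p q : ℕ, a₀ ≤ p → p < q → (q : ℝ) ≤ p + logPlus (classicalLocation (p : ℝ)) ^ 2 →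
      |deBruijnZero t q - deBruijnZero t p -
          4 * π * ((q : ℝ) - p) / logPlus (classicalLocation (p : ℝ))| ≤
        η * logPlus (classicalLocation (p : ℝ)))
    (ha₀ : a₀ ≤ a) (ha : 1 ≤ a) (hWa : ((W : ℕ) : ℝ) ^ 2 ≤ a)
    (hW : ((W : ℕ) : ℝ) ≤ logPlus (classicalLocation (a : ℝ)) ^ 2) (hW1 : 1 ≤ W) {b : ℕ} :
    ∀ m : ℕ, ∀ a' : ℕ, a ≤ a' → a' ≤ b → b - a' ≤ m * W →
      |(deBruijnZero t b - deBruijnZero t a') - (classicalLocation (b : ℝ) - classicalLocation (a' : ℝ))| ≤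
        m * (η * logPlus (classicalLocation (b : ℝ)) + (A₃ + 80 * π)) := by
  have hA : 0 ≤ A₃ + 80 * π := by
    have h0 := classicalLocation_block_estimate h45 ha hWa hW le_rfl (Nat.lt_succ_self a)
      (by
        have h1W : (1 : ℝ) ≤ W := by exact_mod_cast hW1
        push_cast; linarith)
    exact (abs_nonneg _).trans h0
  intro m
  induction m with
  | zero =>
      intro a' haa' ha'b hw
      simp only [zero_mul, Nat.le_zero, Nat.sub_eq_zero_iff_le] at hw
      have : b = a' := le_antisymm hw ha'b
      subst this
      simp
  | succ m ih =>
      intro a' haa' ha'b hw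
      push_cast
      have hLb : 0 ≤ η * logPlus (classicalLocation (b : ℝ)) := by
        have := logPlus_nonneg (classicalLocation (b : ℝ)); positivity
      rcases eq_or_lt_of_le ha'b with rfl | hlt
      · simp only [sub_self, abs_zero]; positivity
      rcases le_or_gt (b - a') W with h1 | h1
      · -- a single block
        have hqp : (b : ℝ) - a' ≤ (W : ℝ) := by
          have : ((b - a' : ℕ) : ℝ) ≤ W := by exact_mod_cast h1
          rwa [Nat.cast_sub ha'b] at this
        have hblk := zero_block_estimate h45 h52 ha₀ ha hWa hW haa' hlt hqp
        have hmono : logPlus (classicalLocation (a' : ℝ)) ≤ logPlus (classicalLocation (b : ℝ)) :=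
          logPlus_classicalLocation_mono (by exact_mod_cast (ha.trans haa')) (by exact_mod_cast ha'b)
        have := mul_le_mul_of_nonneg_left hmono hη
        have hm0 : (0 : ℝ) ≤ m * (η * logPlus (classicalLocation (b : ℝ)) + (A₃ + 80 * π)) := by
          positivity
        linarith
      · -- peel off the first block [a', a' + W]
        set q : ℕ := a' + W with hq
        have haq : a' < q := by omega
        have hqb : q ≤ b := by omega
        have hqa' : (q : ℝ) - a' ≤ (W : ℝ) := by rw [hq]; push_cast; linarith
        have hblk := zero_block_estimate h45 h52 ha₀ ha hWa hW haa' haq hqa'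
        have hrest : b - q ≤ m * W := by
          rw [hq]
          have : b - a' ≤ m * W + W := by rw [Nat.succ_mul] at hw; exact hw
          omega
        have hih := ih q (haa'.trans haq.le) hqb hrest
        have hmono : logPlus (classicalLocation (a' : ℝ)) ≤ logPlus (classicalLocation (b : ℝ)) :=
          logPlus_classicalLocation_mono (by exact_mod_cast (ha.trans haa')) (by exact_mod_cast ha'b)
        have hm' := mul_le_mul_of_nonneg_left hmono hη
        have e : (deBruijnZero t b - deBruijnZero t a') - (classicalLocation (b : ℝ) - classicalLocation (a' : ℝ)) =
            ((deBruijnZero t b - deBruijnZero t q) - (classicalLocation (b : ℝ) - classicalLocation (q : ℝ))) +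
            ((deBruijnZero t q - deBruijnZero t a') - (classicalLocation (q : ℝ) - classicalLocation (a' : ℝ))) := by
          ring
        rw [e]
        refine (abs_add_le _ _).trans ?_
        linarith

end Engine


/-! ## §4. The middle field estimate, symmetry, and «compactness» for bounded indices -/

section Middle

variable {t : ℝ}

/-- **Middle field (regime `ε(j) log₊² ξ_j ≤ |k − j| ≤ ε(j)⁻¹ log₊² ξ_j`), core form.** For
positive indices `a < b` joined by a chain of `m` blocks (§3) with total error
`E = m(η log₊ ξ_b + A₃ + 80π)`: if `E · log₊(ξ_a + ξ_b)/(c₂ (b − a)) ≤ 1/2` then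
`H̃_{ab}(t) ≤ 2 (E log₊(ξ_a + ξ_b)/(c₂(b − a)))²` («`(x_k − x_j)/(ξ_k − ξ_j) − 1 =
o(ε(j)⁻¹ log² j/|k − j|)` … the claim once again follows from (70)», FMP p. 45).
[cite: RodgersTaoFMP2020, Lemma 20 p. 45 (third paragraph of the proof)] -/
theorem renormHamiltonianZ_le_of_chain
    {A₃ η c₂ : ℝ} {a₀ a W : ℕ} (hη : 0 ≤ η)
    (h45 : ∀ p q : ℝ, 1 ≤ p → 1 ≤ q → p ≤ 2 * q → q ≤ 2 * p →
      |classicalLocation q - classicalLocation p -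
          4 * π * (q - p) / Real.log (classicalLocation p / (4 * π))| ≤
        A₃ * ((q - p) ^ 2 / (p * Real.log (classicalLocation p) ^ 2)))
    (h52 : ∀ p q : ℕ, a₀ ≤ p → p < q → (q : ℝ) ≤ p + logPlus (classicalLocation (p : ℝ)) ^ 2 →
      |deBruijnZero t q - deBruijnZero t p -
          4 * π * ((q : ℝ) - p) / logPlus (classicalLocation (p : ℝ))| ≤
        η * logPlus (classicalLocation (p : ℝ)))
    (hc₂ : 0 < c₂)
    (hii : ∀ j k : ℤ, 1 ≤ j → j ≤ k →
      c₂ * (((k : ℝ) - j) / logPlus (classicalLocation (j : ℝ) + classicalLocation (k : ℝ))) ≤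
        classicalLocation (k : ℝ) - classicalLocation (j : ℝ))
    (ha₀ : a₀ ≤ a) (ha : 1 ≤ a) (hWa : ((W : ℕ) : ℝ) ^ 2 ≤ a)
    (hW : ((W : ℕ) : ℝ) ≤ logPlus (classicalLocation (a : ℝ)) ^ 2) (hW1 : 1 ≤ W)
    {b m : ℕ} (hab : a < b) (hm : b - a ≤ m * W)
    (hsmall : m * (η * logPlus (classicalLocation (b : ℝ)) + (A₃ + 80 * π)) *
        logPlus (classicalLocation (a : ℝ) + classicalLocation (b : ℝ)) / (c₂ * ((b : ℝ) - a)) ≤ 1 / 2) :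
    renormHamiltonianZ t a b ≤
      2 * (m * (η * logPlus (classicalLocation (b : ℝ)) + (A₃ + 80 * π)) *
        logPlus (classicalLocation (a : ℝ) + classicalLocation (b : ℝ)) / (c₂ * ((b : ℝ) - a))) ^ 2 := by
  have hchain := zero_chain_estimate hη h45 h52 ha₀ ha hWa hW hW1 m a le_rfl hab.le hm
  set E : ℝ := m * (η * logPlus (classicalLocation (b : ℝ)) + (A₃ + 80 * π)) with hE
  set Λ : ℝ := logPlus (classicalLocation (a : ℝ) + classicalLocation (b : ℝ)) with hΛdef
  have hΛ0 : 0 < Λ := logPlus_pos _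
  have haR : (1 : ℝ) ≤ a := by exact_mod_cast ha
  have habR : (a : ℝ) < b := by exact_mod_cast hab
  have hba0 : 0 < (b : ℝ) - a := by linarith
  set D : ℝ := classicalLocation (a : ℝ) - classicalLocation (b : ℝ) with hD
  set N : ℝ := deBruijnZero t a - deBruijnZero t b with hN
  have hD1 : c₂ * ((b : ℝ) - a) / Λ ≤ -D := by
    have := hii a b (by exact_mod_cast ha) (by exact_mod_cast hab.le)
    push_cast at this
    rw [hD, neg_sub, ← mul_div_assoc] at *
    exact this
  have hd0 : 0 < c₂ * ((b : ℝ) - a) / Λ := by positivity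
  have hDneg : D < 0 := by linarith
  have hDabs : |D| = -D := abs_of_neg hDneg
  have h1 : |N - D| ≤ E := by
    have e : N - D = -((deBruijnZero t b - deBruijnZero t a) -
        (classicalLocation (b : ℝ) - classicalLocation (a : ℝ))) := by rw [hN, hD]; ring
    rw [e, abs_neg]; exact hchain
  have hE0 : 0 ≤ E := (abs_nonneg _).trans h1
  set r : ℝ := N / D with hr
  have hr1 : |r - 1| ≤ E * Λ / (c₂ * ((b : ℝ) - a)) := by
    have hDne : D ≠ 0 := hDneg.ne
    have e : r - 1 = (N - D) / D := by rw [hr]; field_simp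
    rw [e, abs_div, hDabs]
    calc |N - D| / -D ≤ E / (c₂ * ((b : ℝ) - a) / Λ) := div_le_div₀ hE0 h1 hd0 hD1
      _ = E * Λ / (c₂ * ((b : ℝ) - a)) := by field_simp
  have hr2 : |r - 1| ≤ 1 / 2 := hr1.trans hsmall
  have hrhalf : 1 / 2 ≤ r := by have := (abs_le.1 hr2).1; linarith
  have hL : renormHamiltonianZ t a b = renormLog r := by
    rw [renormHamiltonianZ_eq, hr, hN, hD, deBruijnZeroZ_natCast, deBruijnZeroZ_natCast,
      classicalLocationZ_natCast (by omega), classicalLocationZ_natCast (by omega)]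
  rw [hL]
  have hrabs : |r| = r := abs_of_pos (by linarith)
  refine (renormLog_le_two_mul_sq (by rw [hrabs]; exact hrhalf)).trans ?_
  rw [hrabs]
  have h3 : (r - 1) ^ 2 ≤ (E * Λ / (c₂ * ((b : ℝ) - a))) ^ 2 := by
    rw [← sq_abs (r - 1)]
    exact pow_le_pow_left₀ (abs_nonneg _) hr1 2
  linarith

/-- `H̃_{(−j)(−k)} = H̃_{jk}` (odd symmetry of zeros and classical locations).
[cite: RodgersTaoFMP2020, §7 p. 44 (71)] -/
theorem renormHamiltonianZ_neg_neg (t : ℝ) (j k : ℤ) :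
    renormHamiltonianZ t (-j) (-k) = renormHamiltonianZ t j k := by
  rw [renormHamiltonianZ_eq, renormHamiltonianZ_eq, deBruijnZeroZ_neg, deBruijnZeroZ_neg,
    classicalLocationZ_neg, classicalLocationZ_neg,
    show -deBruijnZeroZ t j - -deBruijnZeroZ t k = -(deBruijnZeroZ t j - deBruijnZeroZ t k) by ring,
    show -classicalLocationZ j - -classicalLocationZ k = -(classicalLocationZ j - classicalLocationZ k) by ring,
    neg_div_neg_eq]

/-- **«The bounded case may be treated by compactness»** (FMP p. 45): on a compact time interval
`[t₁, t₂]` above a real-rooted time `t₀`, the finitely many `H̃_{jk}(t)` with `|j|, |k| ≤ J`,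
`j ≠ k`, `j, k ≠ 0`, are bounded by a constant (the zeros stay in a bounded set and keep a uniform
positive distance, by continuity: `exists_bound_deBruijnZeroZ`, `exists_uniform_gap_lower`).
[cite: RodgersTaoFMP2020, Lemma 20 p. 45 («can be treated by compactness»)] -/
theorem exists_renormHamiltonianZ_le_of_bounded {t₀ t₁ t₂ : ℝ} (h01 : t₀ < t₁)
    (hreal : HasOnlyRealZeros (deBruijnH t₀)) (J : ℕ) :
    ∃ C : ℝ, 0 ≤ C ∧ ∀ t ∈ Icc t₁ t₂, ∀ j k : ℤ, j ≠ 0 → k ≠ 0 → j ≠ k →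
      |j| ≤ J → |k| ≤ J → renormHamiltonianZ t j k ≤ C := by
  have hΛ : ∀ t ∈ Icc t₁ t₂, ∃ t' : ℝ, t' < t ∧ HasOnlyRealZeros (deBruijnH t') :=
    fun t ht ↦ ⟨t₀, by linarith [ht.1], hreal⟩
  obtain ⟨M, hM0, hM⟩ := exists_bound_deBruijnZeroZ (t₂ := t₂) hreal h01 (Finset.Icc (-(J : ℤ)) J)
  obtain ⟨g₀, hg₀, hgap⟩ := exists_uniform_gap_lower (t₂ := t₂) h01 hreal J
  obtain ⟨B₀, hB₀, hξB⟩ := exists_abs_classicalLocationZ_le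
  obtain ⟨c₂, C₂, hc₂, -, hii⟩ := RodgersTao2020.lemma31_ii_holds_record
  -- |ξ_j − ξ_k| ≥ c₂/Λ_J and ≤ 2B₀J; |x_j − x_k| ≥ g₀ and ≤ 2M
  set ΛJ : ℝ := logPlus (2 * (B₀ * J)) with hΛJ
  have hΛJ0 : 0 < ΛJ := logPlus_pos _
  refine ⟨2 * M / (c₂ / ΛJ) + max 0 (Real.log (2 * (B₀ * J) / g₀)) + 1, by positivity, ?_⟩
  intro t ht j k hj hk hjk hjJ hkJ
  have hsx := strictMono_deBruijnZeroZ (hΛ t ht)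
  have hsξ := strictMono_classicalLocationZ
  set D : ℝ := classicalLocationZ j - classicalLocationZ k with hD
  set N : ℝ := deBruijnZeroZ t j - deBruijnZeroZ t k with hN
  -- bounds on D
  have hξj := hξB j; have hξk := hξB k
  have hjR : |(j : ℝ)| ≤ J := by exact_mod_cast hjJ
  have hkR : |(k : ℝ)| ≤ J := by exact_mod_cast hkJ
  have hDup : |D| ≤ 2 * (B₀ * J) := by
    rw [hD]
    refine (abs_sub _ _).trans ?_
    have e1 := mul_le_mul_of_nonneg_left hjR hB₀.le
    have e2 := mul_le_mul_of_nonneg_left hkR hB₀.le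
    linarith
  have hΛle : logPlus (|classicalLocationZ j| + |classicalLocationZ k|) ≤ ΛJ := by
    refine logPlus_mono ?_
    rw [abs_of_nonneg (add_nonneg (abs_nonneg (classicalLocationZ j)) (abs_nonneg (classicalLocationZ k))),
      abs_of_nonneg (by positivity : (0 : ℝ) ≤ 2 * (B₀ * J))]
    have e1 := mul_le_mul_of_nonneg_left hjR hB₀.le
    have e2 := mul_le_mul_of_nonneg_left hkR hB₀.le
    linarith
  have hkj1 : 1 ≤ |(k : ℝ) - j| := by
    rw [← Int.cast_sub, ← Int.cast_abs]; exact_mod_cast Int.one_le_abs (sub_ne_zero.2 (Ne.symm hjk))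
  have hDlow : c₂ / ΛJ ≤ |D| := by
    have h1 := (hii j k hj hk).1
    rw [hD, abs_sub_comm (classicalLocationZ j) (classicalLocationZ k)]
    refine le_trans ?_ h1
    calc c₂ / ΛJ ≤ c₂ / logPlus (|classicalLocationZ j| + |classicalLocationZ k|) :=
          div_le_div_of_nonneg_left hc₂.le (logPlus_pos _) hΛle
      _ = c₂ * (1 / logPlus (|classicalLocationZ j| + |classicalLocationZ k|)) := by ring
      _ ≤ c₂ * (|(k : ℝ) - j| / logPlus (|classicalLocationZ j| + |classicalLocationZ k|)) :=
          mul_le_mul_of_nonneg_left (div_le_div_of_nonneg_right hkj1 (logPlus_nonneg _)) hc₂.le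
  have hDpos : 0 < |D| := (div_pos hc₂ hΛJ0).trans_le hDlow
  -- bounds on N
  have hxj := hM t ht j (Finset.mem_Icc.2 (abs_le.1 hjJ))
  have hxk := hM t ht k (Finset.mem_Icc.2 (abs_le.1 hkJ))
  have hNup : |N| ≤ 2 * M := by rw [hN]; exact (abs_sub _ _).trans (by linarith)
  have hNlow : g₀ ≤ |N| := by
    -- reduce to a positive index by symmetry, then use the neighbouring gaps
    have key : ∀ j' k' : ℤ, 0 < j' → k' ≠ j' → |j'| ≤ J →
        g₀ ≤ |deBruijnZeroZ t j' - deBruijnZeroZ t k'| := by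
      intro j' k' hj' hk'j' hj'J
      obtain ⟨n, rfl⟩ := Int.eq_ofNat_of_zero_le hj'.le
      obtain ⟨m, rfl⟩ : ∃ m : ℕ, n = m + 1 := ⟨n - 1, by omega⟩
      have hmJ : m + 1 ≤ J := by
        have : ((m + 1 : ℕ) : ℤ) ≤ J := (le_abs_self _).trans hj'J
        exact_mod_cast this
      have hR := hgap t ht (m + 1) hmJ
      have hL := hgap t ht m (by omega)
      have hmono := hsx.monotone
      rcases lt_or_gt_of_ne hk'j' with h | h
      · rw [abs_of_nonneg (by linarith [hmono h.le])]
        have : deBruijnZeroZ t k' ≤ deBruijnZeroZ t ((m : ℕ) : ℤ) := hmono (by push_cast at h ⊢; omega)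
        rw [deBruijnZeroZ_natCast] at this
        have e : deBruijnZeroZ t ((m + 1 : ℕ) : ℤ) = deBruijnZero t (m + 1) := deBruijnZeroZ_natCast _ _
        rw [e]; linarith
      · rw [abs_of_nonpos (by linarith [hmono h.le])]
        have : deBruijnZeroZ t ((m + 1 + 1 : ℕ) : ℤ) ≤ deBruijnZeroZ t k' := hmono (by push_cast at h ⊢; omega)
        rw [deBruijnZeroZ_natCast] at this
        have e : deBruijnZeroZ t ((m + 1 : ℕ) : ℤ) = deBruijnZero t (m + 1) := deBruijnZeroZ_natCast _ _
        rw [e]; linarith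
    rcases lt_or_gt_of_ne hj with h | h
    · have := key (-j) (-k) (by omega) (by omega) (by rw [abs_neg]; exact hjJ)
      rw [deBruijnZeroZ_neg, deBruijnZeroZ_neg, show -deBruijnZeroZ t j - -deBruijnZeroZ t k =
        -(deBruijnZeroZ t j - deBruijnZeroZ t k) by ring, abs_neg] at this
      rw [hN]; exact this
    · rw [hN]; exact key j k h (Ne.symm hjk) hjJ
  have hNpos : 0 < |N| := hg₀.trans_le hNlow
  -- the ratio
  have hrpos : 0 < N / D := by
    rcases lt_or_gt_of_ne hjk with h | h
    · exact div_pos_of_neg_of_neg (by rw [hN]; linarith [hsx h]) (by rw [hD]; linarith [hsξ h])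
    · exact div_pos (by rw [hN]; linarith [hsx h]) (by rw [hD]; linarith [hsξ h])
  have hr_eq : N / D = |N| / |D| := by rw [← abs_div]; exact (abs_of_pos hrpos).symm
  have h1 : N / D ≤ 2 * M / (c₂ / ΛJ) := by
    rw [hr_eq]; exact div_le_div₀ (by positivity) hNup (div_pos hc₂ hΛJ0) hDlow
  have h2 : Real.log (1 / (N / D)) ≤ Real.log (2 * (B₀ * J) / g₀) := by
    rw [hr_eq, one_div, inv_div]
    have hJ0 : 0 < 2 * (B₀ * (J : ℝ)) := by
      have : (1 : ℝ) ≤ J := by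
        have : 1 ≤ |(j : ℝ)| := by
          rw [← Int.cast_abs]; exact_mod_cast Int.one_le_abs hj
        linarith
      positivity
    exact Real.log_le_log (div_pos hDpos hNpos) (div_le_div₀ hJ0.le hDup hg₀ hNlow)
  rw [renormHamiltonianZ_eq, ← hN, ← hD]
  refine (renormLog_le_add_posLog hrpos).trans ?_
  have h3 : max 0 (Real.log (1 / (N / D))) ≤ max 0 (Real.log (2 * (B₀ * J) / g₀)) := max_le_max le_rfl h2
  linarith

end Middle

end Literature.NumberTheory.LFunctions

end
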